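import Literature.AlgebraicGeometry.Motives.AbelianVarietyIsogenyComplexDescent
import Literature.AlgebraicGeometry.Motives.AbelianVarietyTorsionQuotient
import Summits.HodgeConjecture.HodgeConjecture.Theorems.VHCAbelianSchemesRoadNowhereDisplaceableDefs
import HarnessLib

/-!
# Road №4 (`VHCAbelianSchemesRoad`), crux stmt-HodgeConjecture-26512 `DiagLocalOfMarkmanPinnedForall` — plate (M5) «DESCENT SHAPE»:
# an equivariant complex on `P = J × Ĵ` for the kernel translations of the secant quotient `q : P → Y` descends to `Y`, and
# `q^*•` of the descended complex IS the given one (`quotientPullbackComplex D (D.descendComplex 𝓔 Φ) ≅ 𝓔`)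

research route conditional on HC_CM; not a corollary; Q11.4-sentence-2 already refuted in dim ≥ 3.

Seat core-w5 g8 (claim-free; `--supports stmt-HodgeConjecture-26512 --as helper`; 0 named facts; director-hodge g19 R19.72 (4) plates
(M5-i) ∕ (M5-iii), LEAD 167 l.6384). THE (M5-i) READING IS A THEOREM OF THE TREE, NOT A PRINT POINT: `D.q = secantQuotientMap … =
(J × Ĵ).torsionQuotHom hn Ḡ _` is a complex isogeny (`D.isIsogeny_q`), and EVERY complex isogeny `f` is a free affine geometric quotient by
the translations of its kernel in the currency of the descent theorems (`Motives/AbelianVarietyIsogenyGeometricQuotient`: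
`isGeometricQuotient_kerTranslationActionOver`, `isAffineHom_of_isIsogeny`, `kerTranslationActionOver_free` — Mumford §7 Thm. 4 by
recognition), with `Ker q(ℂ) = Ḡ = rouquierImage …` on the nose (`kerPoints_q_eq`). So this file is a SPECIALISATION of
`Motives/AbelianVarietyIsogenyComplexDescent` (itself a discharge of `RelativeSpec/EquivariantComplexDescent`) to `D : SecantQuotientDatum`,
in the socket's vocabulary `quotientPullbackComplex` (`…NowhereDisplaceableDefs`):

* `SecantQuotientDatum.kerPointsFintype` (a `@[reducible] def`, bind with `letI`), `kerPoints_q_eq : Ker q(ℂ) = Ḡ`;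
* **`SecantQuotientDatum.descendComplex D 𝓔 Φ`** — the complex `(q_*• 𝓔)^Ḡ` on `Y` of a complex `𝓔` of `𝒪_P`-modules with a
  `Ker q(ℂ)`-EQUIVARIANT STRUCTURE `Φ : (kerTranslationActionOver D.q).EquivariantComplexStructure 𝓔` (termwise linearisations
  `t_x^* 𝓔ⁱ ≅ 𝓔ⁱ`, unit, cocycle, commuting with `d` — (M5-ii), `RelativeSpec/EquivariantComplexDescent`);
* **`SecantQuotientDatum.quotientPullbackDescendComplexIso : quotientPullbackComplex D (D.descendComplex 𝓔 Φ) ≅ 𝓔`** for termwise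
  quasi-coherent `𝓔` — (M5-iii): an ISOMORPHISM OF COMPLEXES (so a quasi-isomorphism for free, `quasiIso_quotientPullbackDescendComplexIso_hom`);
* **`SecantQuotientDatum.isBoundedVBComplex_descendComplex`** — bounded VB upstairs ⇒ bounded VB downstairs (the socket's `𝓓.E` shape);
* **`SecantQuotientDatum.exists_isBoundedVBComplex_quotientPullback_iso`** — the print-shaped packaging: for a bounded VB complex `𝓔` on
  `P` with a `Ker q(ℂ)`-equivariant structure, `∃ E` bounded VB on `Y` and `f : quotientPullbackComplex D E ⟶ 𝓔` an isomorphism (hence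
  `QuasiIso f`) — with `𝓔 := (L^{⊗a})^∨ ⊗• 𝓔'` this is LITERALLY the binder `f` of sockets #1–#3 (`…OneNonJumpingPointOfInputs*`), whose
  ONLY remaining input is therefore the equivariant structure `Φ` on the twisted complex ([Markman2025SecantWeil] Lemma 9.3.5:
  `λ ⊗ (∧^r λ)^a` on `𝒢 ⊗ D^a`; Remark 9.3.7: «descends to an object in `D^b(Y)`»).

WHAT THIS FILE DOES NOT SAY: that any particular `𝓔` (e.g. a model of `Φ̃(box₂) ⊗ D^a`) CARRIES such a `Φ` — that is the cocycle content
of Lemma 9.3.5 (binder-owner ledger B5: (α-R) ∕ (1d)); nothing here says (1d), (M5)'s input exists, (O₁), (N-U♭), (N-U), any stub, the crux, №4,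
HC_AV, HC_CM or HC holds; HC_CM HELD, by name only; helper lane (width 0). References: [cite: MumfordAV1970, §7 Thm. 4 (p. 72), §12 Thm. 1 (p. 112)]
[cite: Markman2025SecantWeil, §9.3 Lemma 9.3.5 and Remark 9.3.7] [cite: SGA1, Exp. VIII Thm. 1.1, Prop. 1.10].
-/

noncomputable section

-- `TopCat.Presheaf`/`Scheme.Modules` are not reducible (as in Mathlib's `AlgebraicGeometry/Modules/Sheaf.lean`).
set_option backward.isDefEq.respectTransparency false

open CategoryTheory CategoryTheory.Limits AlgebraicGeometry

namespace Summit.HodgeConjecture.HodgeConjecture.Ring2.SemiregularRepresentatives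

set_option linter.dupNamespace false -- the cell's namespace repeats the summit name, as in every `Ring2*` file

open Literature.AlgebraicGeometry Literature.AlgebraicGeometry.Motives Literature.AlgebraicGeometry.Motives.AbelianVariety
open Literature.AlgebraicGeometry.RelativeSpec Literature.AlgebraicGeometry.KTheory Literature.AlgebraicGeometry.Markman2025
open Summit.HodgeConjecture.HodgeConjecture.Ring2.SemiregularRepresentatives.NowhereDisplaceable

namespace SecantQuotientDatum

variable (D : SecantQuotientDatum)

/-! ## §1 (M5-i): the kernel of `q` as a finite group of translations — `Ker q(ℂ) = Ḡ` -/

/-- **`Ker q(ℂ) = Ḡ`**: the kernel of the secant quotient map on complex points is Markman's `Ḡ = rouquierImage …` ON THE NOSE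
(`kerPoints_torsionQuotHom_eq`). [cite: MumfordAV1970, §7 Thm. 4 (p. 72)] [cite: Markman2025SecantWeil, §9.3 Lemma 9.3.3] -/
theorem kerPoints_q_eq : Hom.kerPoints (specOver ℂ ℂ) D.q = rouquierImage D.𝒥.J D.isAmple D.G₁ D.G₂ :=
  D.P.kerPoints_torsionQuotHom_eq D.succ_ne_zero _ (rouquierImage_le_torsionPoints D.G₁_le D.G₂_le)

/-- The `Fintype` structure on `Ker q(ℂ)` (a `@[reducible] def`; bind with `letI := D.kerPointsFintype`). [cite: MumfordAV1970, §7 Thm. 4 (p. 72)] -/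
@[reducible]
def kerPointsFintype : Fintype ↥(Hom.kerPoints (specOver ℂ ℂ) D.q) :=
  AbelianVariety.kerPointsFintype D.q D.isIsogeny_q

/-- `#Ker q(ℂ) = (d+1)²`. [cite: Markman2025SecantWeil, §1.5 (p. 7) and §9.3 Lemma 9.3.3] -/
theorem natCard_kerPoints_q : Nat.card ↥(Hom.kerPoints (specOver ℂ ℂ) D.q) = (D.d + 1) * (D.d + 1) := by
  rw [← D.natCard_rouquierImage]
  exact Nat.card_congr (Equiv.subtypeEquivRight fun x => SetLike.ext_iff.mp D.kerPoints_q_eq x)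

/-! ## §2 (M5-ii)+(M5-iii): the descended complex and `q^*•(descendComplex) ≅ 𝓔` -/

variable {κ : Type*} {c : ComplexShape κ}

/-- **The descended complex `(q_*• 𝓔)^Ḡ` on `Y`** of a complex `𝓔` of `𝒪_P`-modules with a `Ker q(ℂ)`-equivariant structure `Φ`
(`RelativeSpec/EquivariantComplexDescent.descendComplex` for `kerTranslationActionOver D.q`). [cite: MumfordAV1970, §12 Thm. 1 (p. 112)]
[cite: Markman2025SecantWeil, §9.3 Remark 9.3.7] -/
def descendComplex (𝓔 : HomologicalComplex D.P.X.left.Modules c) (Φ : (kerTranslationActionOver D.q).EquivariantComplexStructure 𝓔) :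
    HomologicalComplex D.Y.X.left.Modules c :=
  letI := D.kerPointsFintype
  (kerTranslationActionOver D.q).descendComplex 𝓔 Φ

/-- The terms of the descended complex are the modules of invariants `(q_* 𝓔ⁱ)^Ḡ` (definitional). [cite: MumfordAV1970, §12 Thm. 1 (p. 112)] -/
theorem descendComplex_X (𝓔 : HomologicalComplex D.P.X.left.Modules c) (Φ : (kerTranslationActionOver D.q).EquivariantComplexStructure 𝓔) (i : κ) :
    (D.descendComplex 𝓔 Φ).X i = (letI := D.kerPointsFintype; (kerTranslationActionOver D.q).moduleInvariants (𝓔.X i) (Φ.term i).iso) :=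
  rfl

/-- **(M5-iii) `quotientPullbackComplex D (D.descendComplex 𝓔 Φ) ≅ 𝓔`** — an ISOMORPHISM OF COMPLEXES on `P = J × Ĵ`, for every termwise
quasi-coherent complex `𝓔` with a `Ker q(ℂ)`-equivariant structure (`isogenyPullbackDescendComplexIso` at `f = D.q`; the socket's `q^*•` is
`quotientPullbackComplex` by `rfl`). [cite: MumfordAV1970, §7 Thm. 4 (p. 72) and §12 Thm. 1 (p. 112)] [cite: Markman2025SecantWeil, §9.3 Remark 9.3.7] -/
def quotientPullbackDescendComplexIso (𝓔 : CochainComplex D.P.X.left.Modules ℤ) [∀ i, (𝓔.X i).IsQuasicoherent]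
    (Φ : (kerTranslationActionOver D.q).EquivariantComplexStructure 𝓔) :
    quotientPullbackComplex D (D.descendComplex 𝓔 Φ) ≅ 𝓔 :=
  letI := D.kerPointsFintype
  isogenyPullbackDescendComplexIso D.q D.isIsogeny_q 𝓔 Φ

/-- The components of the comparison are the Chase–Harrison–Rosenberg isomorphisms `descentHom : q^*(q_* 𝓔ⁱ)^Ḡ ⟶ 𝓔ⁱ` (definitional).
[cite: MumfordAV1970, §12 Thm. 1 (p. 112)] -/
theorem quotientPullbackDescendComplexIso_hom_f (𝓔 : CochainComplex D.P.X.left.Modules ℤ) [∀ i, (𝓔.X i).IsQuasicoherent]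
    (Φ : (kerTranslationActionOver D.q).EquivariantComplexStructure 𝓔) (i : ℤ) :
    (D.quotientPullbackDescendComplexIso 𝓔 Φ).hom.f i =
      (letI := D.kerPointsFintype; (kerTranslationActionOver D.q).descentHom (𝓔.X i) (Φ.term i).iso) :=
  rfl

/-- The comparison is a quasi-isomorphism (it is an isomorphism of complexes). [cite: MumfordAV1970, §12 Thm. 1 (p. 112)] -/
theorem quasiIso_quotientPullbackDescendComplexIso_hom (𝓔 : CochainComplex D.P.X.left.Modules ℤ) [∀ i, (𝓔.X i).IsQuasicoherent]
    (Φ : (kerTranslationActionOver D.q).EquivariantComplexStructure 𝓔) :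
    QuasiIso (D.quotientPullbackDescendComplexIso 𝓔 Φ).hom :=
  inferInstance

/-- The comparison intertwines the canonical equivariant structure of `q^*•` with `Φ`, degreewise. [cite: MumfordAV1970, §12 Thm. 1 (p. 112)] -/
theorem pullback_map_quotientPullbackDescendComplexIso_hom_f_comp (𝓔 : CochainComplex D.P.X.left.Modules ℤ) [∀ i, (𝓔.X i).IsQuasicoherent]
    (Φ : (kerTranslationActionOver D.q).EquivariantComplexStructure 𝓔) (x : Hom.kerPoints (specOver ℂ ℂ) D.q) (i : ℤ) :
    (Scheme.Modules.pullback ((kerTranslationActionOver D.q).aut x).hom).map ((D.quotientPullbackDescendComplexIso 𝓔 Φ).hom.f i) ≫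
        ((Φ.term i).iso x).hom =
      (letI := D.kerPointsFintype
       (((ActionOver.EquivariantComplexStructure.ofPullback ((kerTranslationActionOver D.q).descendComplex 𝓔 Φ)).term i).iso x).hom) ≫
        (D.quotientPullbackDescendComplexIso 𝓔 Φ).hom.f i :=
  letI := D.kerPointsFintype
  pullback_map_isogenyPullbackDescendComplexIso_hom_f_comp D.q D.isIsogeny_q 𝓔 Φ x i

/-- **Bounded VB upstairs ⇒ bounded VB downstairs**: if `𝓔` is a bounded complex of vector bundles, so is `D.descendComplex 𝓔 Φ`
(the shape of the socket's `𝓓.E : PinnedTwistedDatum`, field `bounded`). [cite: SGA1, Exp. VIII Prop. 1.10] [cite: MumfordAV1970, §12 Thm. 1 (p. 112)] -/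
theorem isBoundedVBComplex_descendComplex (𝓔 : CochainComplex D.P.X.left.Modules ℤ) (Φ : (kerTranslationActionOver D.q).EquivariantComplexStructure 𝓔)
    (h𝓔 : IsBoundedVBComplex 𝓔) : IsBoundedVBComplex (D.descendComplex 𝓔 Φ) :=
  letI := D.kerPointsFintype
  isBoundedVBComplex_descendComplex_kerTranslation D.q D.isIsogeny_q 𝓔 Φ h𝓔

/-- **The socket's `f`, manufactured**: for a bounded complex of vector bundles `𝓔` on `P = J × Ĵ` with a `Ker q(ℂ)`-equivariant structure
there are a bounded complex of vector bundles `E` on `Y` and an ISOMORPHISM `f : quotientPullbackComplex D E ⟶ 𝓔` (so `QuasiIso f`). With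
`𝓔 := (L^{⊗a})^∨ ⊗• 𝓔'` this is the binder `f` of `not_mem_extJumpLocus_quotientPullback_of_twoTorsion_inputs_*` — its one remaining input is
the equivariant structure on the twisted complex (Markman Lemma 9.3.5). [cite: Markman2025SecantWeil, §9.3 Lemma 9.3.5 and Remark 9.3.7]
[cite: MumfordAV1970, §12 Thm. 1 (p. 112)] -/
theorem exists_isBoundedVBComplex_quotientPullback_iso (𝓔 : CochainComplex D.P.X.left.Modules ℤ) (h𝓔 : IsBoundedVBComplex 𝓔)
    (Φ : (kerTranslationActionOver D.q).EquivariantComplexStructure 𝓔) :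
    ∃ E : CochainComplex D.Y.X.left.Modules ℤ, IsBoundedVBComplex E ∧
      ∃ f : quotientPullbackComplex D E ⟶ 𝓔, IsIso f ∧ QuasiIso f := by
  haveI : ∀ i, SheafOfModules.IsLocallyFree (𝓔.X i) := fun i => (h𝓔.isFiniteLocallyFree i).isVectorBundle.1
  exact ⟨D.descendComplex 𝓔 Φ, D.isBoundedVBComplex_descendComplex 𝓔 Φ h𝓔, (D.quotientPullbackDescendComplexIso 𝓔 Φ).hom,
    inferInstance, inferInstance⟩

end SecantQuotientDatum

end Summit.HodgeConjecture.HodgeConjecture.Ring2.SemiregularRepresentatives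

end
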